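import Summits.NavierStokesRegularity.NavierStokesRegularity.Theorems.FilamentSkeletonRssCoreLinearInvertibilityArnoldHighModesToolsA
import Summits.NavierStokesRegularity.NavierStokesRegularity.Theorems.FilamentSkeletonRssCoreLinearInvertibilityArnoldHighModesToolsB
import Summits.NavierStokesRegularity.NavierStokesRegularity.Theorems.FilamentSkeletonRssCoreLinearInvertibilityArnoldHighModesToolsC
import Summits.NavierStokesRegularity.NavierStokesRegularity.Theorems.FilamentSkeletonRssCoreLinearInvertibilityOddArnoldToolsA
import Summits.NavierStokesRegularity.NavierStokesRegularity.Theorems.FilamentSkeletonRssCoreLinearInvertibilityOddArnoldToolsB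

/-!
# Crux `CoreLinearInvertibility` (stmt-NavierStokesRegularity-17973), line `Sketch`, stub
# `stub_arnoldHighModes`: explicit Arnold coercivity on odd densities without `k = ±1` modes

For a continuous, odd, Gaussian-class density `ω_r` on `ℝ² = EuclideanSpace ℝ (Fin 2)` whose `k = ±1`
circle coefficients vanish (`∫_{−π}^{π} ω_r(γ_ρ) cos = ∫_{−π}^{π} ω_r(γ_ρ) sin = 0`, `ρ > 0`) and its
logarithmic potential `ψ = N ∗ ω_r` (`N = (2π)⁻¹ log ‖·‖`):

  `∫ ω_r ψ ≥ −(19/20) ∫ Φ⁻¹ ω_r²`,  `Φ = kerWeight`, `Φ(r) = (r²/4)/(e^{r²/4} − 1) = 1/𝒜`.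

This is the `|k| ≥ 2` (here, by oddness, `|k| ≥ 3`) half of Gallay–Šverák's Theorem 2.5 at the
Gaussian vortex with an explicit constant. Chain of the proof:

1. `ω_r` is neutral (odd), so the energy identity `E := ∫ ‖∇ψ‖² = −∫ ψ ω_r` holds, with
   `‖∇ψ‖² ∈ L¹` (tools A, derivative of `ψ` gained from the kernel — `ω_r` is only continuous);
2. `ψ` is `C¹`, odd, and inherits the vanishing of the `k = ±1` circle coefficients (tools C);
3. Hardy–Wirtinger with constant `1/3` on circles and `Φ r² ≤ 14/5` give
   `∫ Φ ψ² ≤ (14/15) E` (tools B);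
4. weighted Cauchy–Schwarz: `E = |∫ ψ ω_r| ≤ (∫ Φ ψ²)^{1/2} (∫ Φ⁻¹ ω_r²)^{1/2}`, hence
   `E ≤ (14/15) ∫ Φ⁻¹ ω_r² ≤ (19/20) ∫ Φ⁻¹ ω_r²`, i.e. `∫ ω_r ψ = −E ≥ −(19/20) ∫ Φ⁻¹ ω_r²`.

## References

* Th. Gallay, V. Šverák, *Arnold's variational principle and its application to the stability of
  planar vortices*, arXiv:2110.13739 = Analysis & PDE 17 (2024) 681–722, §2.1 (proof of Thm. 2.5:
  Fourier decomposition, the modes `|k| ≥ 2`), §4.1 Lemma 4.1 (the Gaussian weight). [GallaySverak2021]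
* Th. Gallay, C. E. Wayne, Comm. Math. Phys. 255 (2005) §4 (Hardy-type inequalities in the
  stability analysis of the Oseen vortex).
-/

set_option linter.dupNamespace false

noncomputable section

namespace Summit.NavierStokesRegularity.NavierStokesRegularity.Theorems

open Set Function Filter MeasureTheory Topology Metric
open Literature.Analysis.FluidPDE
open scoped InnerProductSpace Real

/-- **Explicit Arnold coercivity on odd Gaussian-class densities with no `k = ±1` modes**
(registered stub `stub_arnoldHighModes` of line `Sketch`, crux `CoreLinearInvertibility`):
`∫ ω_r ψ_{ω_r} ≥ −(19/20) ∫ Φ⁻¹ ω_r²` — energy identity for the potential of a neutral continuous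
density, transfer of the vanishing `k = ±1` coefficients to `ψ`, Hardy–Wirtinger with constant `1/3`
and `Φ|x|² ≤ 14/5`, weighted Cauchy–Schwarz. -/
theorem stub_arnoldHighModes :
    ∀ omr : EuclideanSpace ℝ (Fin 2) → ℝ, Continuous omr →
    (∃ (C : ℝ) (N : ℕ), ∀ x, |omr x| ≤ C * (1 + ‖x‖) ^ N * Real.exp (-(‖x‖ ^ 2 / 4))) →
    (∀ x, omr (-x) = -omr x) →
    (∀ r : ℝ, 0 < r →
      ∫ θ in (-Real.pi)..Real.pi, omr (circlePt r θ) * Real.cos θ = 0 ∧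
      ∫ θ in (-Real.pi)..Real.pi, omr (circlePt r θ) * Real.sin θ = 0) →
    -((19 / 20 : ℝ) * ∫ x, (kerWeight ‖x‖)⁻¹ * omr x ^ 2) ≤
      ∫ x, omr x * ∫ y, (2 * Real.pi)⁻¹ * Real.log ‖x - y‖ * omr y := by
  intro omr homc hgc hodd hmode
  -- Gaussian bound and neutrality
  obtain ⟨B, -, hB⟩ := arnold_gc_exp_eighth hgc
  have hneutral : ∫ x, omr x = 0 := by
    have h1 := integral_neg_eq_self omr volume
    have h2 : ∫ x, omr (-x) = -∫ x, omr x := by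
      rw [← integral_neg]
      exact integral_congr_ae (Eventually.of_forall fun x => hodd x)
    linarith
  -- the potential `ψ = N ∗ ω_r`
  obtain ⟨ψ, hψ⟩ : ∃ ψ : EuclideanSpace ℝ (Fin 2) → ℝ,
      ψ = fun x => ∫ y, (2 * Real.pi)⁻¹ * Real.log ‖x - y‖ * omr y := ⟨_, rfl⟩
  have hψx : ∀ x, (∫ y, (2 * Real.pi)⁻¹ * Real.log ‖x - y‖ * omr y) = ψ x := fun x => by rw [hψ]
  simp_rw [hψx]
  -- Step 1: the energy identity (tools A)
  obtain ⟨hC1, -, hI1, -, hE⟩ := stub_arnoldHighModesToolsA B omr homc hB hneutral ψ hψ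
  -- Step 2: `ψ` is odd with vanishing `k = ±1` circle coefficients (tools C)
  have hψodd : ∀ x, ψ (-x) = -ψ x := fun x => by
    rw [← hψx, ← hψx]; exact arnold_logPotential_neg_of_odd hodd x
  have hψmode : ∀ r : ℝ, 0 < r → (∫ θ in (-π)..π, ψ (circlePt r θ) * Real.cos θ = 0) ∧
      ∫ θ in (-π)..π, ψ (circlePt r θ) * Real.sin θ = 0 := fun r _ => by
    have h := highModes_logPotential_modeOne_eq_zero homc hB hmode r
    simp only [hψx] at h
    exact h
  -- Step 3: Hardy–Wirtinger against the kernel weight (tools B)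
  obtain ⟨hΦψ, hHW⟩ := highModes_integral_kerWeight_mul_sq_le ψ hC1 hψodd hψmode hI1
  -- Step 4: weighted Cauchy–Schwarz `|∫ ψ ω_r| ≤ (∫ Φ ψ²)^{1/2} (∫ Φ⁻¹ ω_r²)^{1/2}`
  have hΦpos : ∀ x : EuclideanSpace ℝ (Fin 2), 0 < kerWeight ‖x‖ := fun x => kerWeight_pos _
  have hginv : ∀ x : EuclideanSpace ℝ (Fin 2), 0 ≤ (kerWeight ‖x‖)⁻¹ := fun x => inv_nonneg.2 (hΦpos x).le
  have hΦc : Continuous fun x : EuclideanSpace ℝ (Fin 2) => kerWeight ‖x‖ :=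
    continuous_kerWeight.comp continuous_norm
  have hginvm : AEStronglyMeasurable (fun x : EuclideanSpace ℝ (Fin 2) => (kerWeight ‖x‖)⁻¹) volume :=
    (hΦc.inv₀ fun x => (kerWeight_pos _).ne').aestronglyMeasurable
  have hωΦ : Integrable fun x => (kerWeight ‖x‖)⁻¹ * omr x ^ 2 :=
    arnold_integrable_inv_kerWeight_mul_sq homc.aestronglyMeasurable hgc
  have hpt : ∀ x, (kerWeight ‖x‖)⁻¹ * (kerWeight ‖x‖ * ψ x) ^ 2 = kerWeight ‖x‖ * ψ x ^ 2 := fun x => by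
    have := (hΦpos x).ne'
    field_simp
  have ha : Integrable fun x => (kerWeight ‖x‖)⁻¹ * (kerWeight ‖x‖ * ψ x) ^ 2 :=
    hΦψ.congr (Eventually.of_forall fun x => (hpt x).symm)
  obtain ⟨-, hcs⟩ := abs_integral_weight_mul_mul_le (μ := volume) (a := fun x => kerWeight ‖x‖ * ψ x)
    (b := omr) hginv hginvm (hΦc.mul hC1.continuous).aestronglyMeasurable homc.aestronglyMeasurable ha hωΦ
  have e1 : ∫ x, (kerWeight ‖x‖)⁻¹ * ((kerWeight ‖x‖ * ψ x) * omr x) = ∫ x, ψ x * omr x :=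
    integral_congr_ae (Eventually.of_forall fun x => by
      have := (hΦpos x).ne'
      simp only
      field_simp)
  have e2 : ∫ x, (kerWeight ‖x‖)⁻¹ * (kerWeight ‖x‖ * ψ x) ^ 2 = ∫ x, kerWeight ‖x‖ * ψ x ^ 2 :=
    integral_congr_ae (Eventually.of_forall hpt)
  rw [e1, e2] at hcs
  -- Step 5: the algebra `E ≤ (14/15) ∫ Φ⁻¹ ω_r²`
  obtain ⟨I, hI⟩ : ∃ I : ℝ, I = ∫ x, (kerWeight ‖x‖)⁻¹ * omr x ^ 2 := ⟨_, rfl⟩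
  obtain ⟨E, hEdef⟩ : ∃ E : ℝ, E = ∫ x, ‖gradient ψ x‖ ^ 2 := ⟨_, rfl⟩
  rw [← hI] at hcs ⊢
  rw [← hEdef] at hE hHW
  have hE0 : 0 ≤ E := hEdef ▸ integral_nonneg fun x => sq_nonneg _
  have hI0 : 0 ≤ I := hI ▸ integral_nonneg fun x => mul_nonneg (hginv x) (sq_nonneg _)
  have hJ0 : 0 ≤ ∫ x, kerWeight ‖x‖ * ψ x ^ 2 := integral_nonneg fun x => mul_nonneg (hΦpos x).le (sq_nonneg _)
  have habs : |∫ x, ψ x * omr x| = E := by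
    rw [show (∫ x, ψ x * omr x) = -E by linarith, abs_neg, abs_of_nonneg hE0]
  rw [habs] at hcs
  have h2 : E ^ 2 ≤ (14 / 15 * E) * I := by
    calc E ^ 2 ≤ (Real.sqrt (∫ x, kerWeight ‖x‖ * ψ x ^ 2) * Real.sqrt I) ^ 2 :=
          pow_le_pow_left₀ hE0 hcs 2
      _ = (∫ x, kerWeight ‖x‖ * ψ x ^ 2) * I := by
          rw [mul_pow, Real.sq_sqrt hJ0, Real.sq_sqrt hI0]
      _ ≤ (14 / 15 * E) * I := mul_le_mul_of_nonneg_right hHW hI0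
  have hEle : E ≤ 14 / 15 * I := by
    by_contra hlt
    rw [not_le] at hlt
    have hEpos : 0 < E := lt_of_le_of_lt (by positivity) hlt
    have h3 : E * E ≤ (14 / 15 * I) * E := by nlinarith [h2]
    have := le_of_mul_le_mul_right h3 hEpos
    linarith
  -- conclusion
  have e3 : ∫ x, omr x * ψ x = ∫ x, ψ x * omr x :=
    integral_congr_ae (Eventually.of_forall fun x => mul_comm _ _)
  rw [e3]
  linarith

end Summit.NavierStokesRegularity.NavierStokesRegularity.Theorems
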